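import Literature.NumberTheory.LFunctions.SelbergClassStrongMultiplicityOne
import Mathlib.NumberTheory.LSeries.Injectivity
import Mathlib.Analysis.Complex.CauchyIntegral
import HarnessLib

/-!
# Strong multiplicity one for the Selberg class (Soundararajan 2004): proofs, layer 1

Sibling proofs file (D-0014 append protocol) of
`Literature/NumberTheory/LFunctions/SelbergClassStrongMultiplicityOne.lean`, which vendors
K. Soundararajan, *Strong multiplicity one for the Selberg class*, Canad. Math. Bull. 47 (2004)
468–474 = arXiv:math/0210299, Theorem (p. 1), as the named fact
`Literature.NumberTheory.LFunctions.Soundararajan2004_strongMultiplicityOne_thinSet`.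

This file holds the bottom layer of the formalisation of the printed proof and is a pure proof
file (theorems only; no definitions, no named facts).

## Layer 1: the shape of the conclusion "`F = G`"

The analytic core of the printed argument (explicit formula, pp. 2–3 of the arXiv version) shows
`c(n) = b_F(n) − b_G(n) = 0` for every `n`, i.e. `log F = log G` and hence `F = G` on `re s > 1`
(Euler product axiom (v)). The lemmas below turn agreement of two Selberg data on `re s > 1` into
the formal conclusion of the named fact — the same Dirichlet coefficients at every `n ≥ 1`
(a somewhere-convergent Dirichlet series determines its coefficients, Mathlib's
`LSeries.eq_of_LSeries_eventually_eq`) and the same function off `s = 1` (continuation axiom (ii)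
and the identity theorem):

* `SelbergDatum.abscissaOfAbsConv_coeff_le_one` — `σ_a(F) ≤ 1` (Ramanujan axiom).
* `SelbergDatum.coeff_eq_of_eqOn` — `F₁ = F₂` on `re s > 1` ⇒ `a₁(n) = a₂(n)` (`n ≥ 1`).
* `SelbergDatum.toFun_eq_of_eqOn` — `F₁ = F₂` on `re s > 1` ⇒ `F₁(s) = F₂(s)` for `s ≠ 1`.
* `SelbergDatum.coeff_eq_and_toFun_eq_of_eqOn` — both, in the shape of the fact's conclusion.

## References

* K. Soundararajan, *Strong multiplicity one for the Selberg class*, Canad. Math. Bull. 47 (2004)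
  468–474; arXiv:math/0210299. [Soundararajan2002]
* A. Selberg, *Old and new conjectures and results about a class of Dirichlet series* (1992),
  §1 (axioms (i), (ii), (v)). [Selberg1992]
-/

noncomputable section

open Complex Filter Topology Set

namespace Literature.NumberTheory.LFunctions

namespace SelbergDatum

/-- The Dirichlet series of `F ∈ 𝒮` has abscissa of absolute convergence `≤ 1` (Ramanujan axiom;
Selberg 1992, axiom (i)). [folklore] -/
theorem abscissaOfAbsConv_coeff_le_one (D : SelbergDatum) :
    LSeries.abscissaOfAbsConv D.coeff ≤ 1 :=
  LSeries.abscissaOfAbsConv_le_of_forall_lt_LSeriesSummable fun y hy ↦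
    D.LSeriesSummable_coeff y (by simpa using hy)

/-- Two Selberg data whose functions agree on `re s > 1` have the same Dirichlet coefficients
`a(n)`, `n ≥ 1` (a convergent Dirichlet series determines its coefficients). [folklore] -/
theorem coeff_eq_of_eqOn (D₁ D₂ : SelbergDatum) (h : Set.EqOn D₁.toFun D₂.toFun {s | 1 < s.re})
    {n : ℕ} (hn : n ≠ 0) : D₁.coeff n = D₂.coeff n := by
  refine LSeries.eq_of_LSeries_eventually_eq
    (D₁.abscissaOfAbsConv_coeff_le_one.trans_lt (EReal.coe_lt_top 1))
    (D₂.abscissaOfAbsConv_coeff_le_one.trans_lt (EReal.coe_lt_top 1)) ?_ hn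
  filter_upwards [eventually_gt_atTop 1] with x hx
  have hx' : 1 < (x : ℂ).re := by simpa using hx
  rw [← D₁.eqOn_LSeries hx', ← D₂.eqOn_LSeries hx']
  exact h hx'

/-- Two Selberg data whose functions agree on `re s > 1` agree at every `s ≠ 1`: with `Gᵢ` entire,
`Gᵢ(s) = (s-1)^{mᵢ} Fᵢ(s)` off `s = 1` (continuation axiom), the entire function
`(s-1)^{m₂} G₁ - (s-1)^{m₁} G₂` vanishes on `re s > 1`, hence everywhere (identity theorem).
[folklore] -/
theorem toFun_eq_of_eqOn (D₁ D₂ : SelbergDatum) (h : Set.EqOn D₁.toFun D₂.toFun {s | 1 < s.re})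
    {s : ℂ} (hs : s ≠ 1) : D₁.toFun s = D₂.toFun s := by
  obtain ⟨G₁, hG₁, hG₁F⟩ := D₁.differentiable
  obtain ⟨G₂, hG₂, hG₂F⟩ := D₂.differentiable
  set H : ℂ → ℂ := fun z ↦ (z - 1) ^ D₂.polarOrder * G₁ z - (z - 1) ^ D₁.polarOrder * G₂ z
    with hH
  have hHd : Differentiable ℂ H := by
    simp only [hH]
    fun_prop
  have hHan : AnalyticOnNhd ℂ H univ := hHd.differentiableOn.analyticOnNhd isOpen_univ
  have hH0 : H =ᶠ[𝓝 (2 : ℂ)] 0 := by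
    have hopen : IsOpen {z : ℂ | 1 < z.re} := isOpen_lt continuous_const Complex.continuous_re
    filter_upwards [hopen.mem_nhds (show (2 : ℂ) ∈ {z : ℂ | 1 < z.re} by simp)] with z hz
    have hz1 : z ≠ 1 := by
      rintro rfl
      simp at hz
    simp only [hH, hG₁F z hz1, hG₂F z hz1, h hz, Pi.zero_apply]
    ring
  have hHz := hHan.eqOn_zero_of_preconnected_of_eventuallyEq_zero isPreconnected_univ
    (mem_univ (2 : ℂ)) hH0 (mem_univ s)
  simp only [hH, hG₁F s hs, hG₂F s hs, Pi.zero_apply] at hHz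
  have hs1 : (s - 1) ≠ 0 := sub_ne_zero.mpr hs
  have key : (s - 1) ^ D₂.polarOrder * (s - 1) ^ D₁.polarOrder * (D₁.toFun s - D₂.toFun s) = 0 := by
    rw [← hHz]; ring
  rcases mul_eq_zero.mp key with h' | h'
  · exact absurd h' (mul_ne_zero (pow_ne_zero _ hs1) (pow_ne_zero _ hs1))
  · exact sub_eq_zero.mp h'

/-- If two Selberg data have the same function on `re s > 1`, then they have the same Dirichlet
coefficients at every `n ≥ 1` and the same function off `s = 1` — the shape of the conclusion
"`F = G`" in `Soundararajan2004_strongMultiplicityOne_thinSet`. [folklore] -/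
theorem coeff_eq_and_toFun_eq_of_eqOn (D₁ D₂ : SelbergDatum)
    (h : Set.EqOn D₁.toFun D₂.toFun {s | 1 < s.re}) :
    (∀ n : ℕ, 1 ≤ n → D₁.coeff n = D₂.coeff n) ∧ ∀ s : ℂ, s ≠ 1 → D₁.toFun s = D₂.toFun s :=
  ⟨fun _ hn ↦ D₁.coeff_eq_of_eqOn D₂ h (Nat.one_le_iff_ne_zero.mp hn),
    fun _ hs ↦ D₁.toFun_eq_of_eqOn D₂ h hs⟩

end SelbergDatum

end Literature.NumberTheory.LFunctions

end
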